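import Summits.MatrixMultiplication.MatrixMultiplication.Theses.CondensationDistance
import Summits.MatrixMultiplication.MatrixMultiplication.Theorems.CondensationDistanceShortCondensationStubTransportStepSchur
import Summits.MatrixMultiplication.MatrixMultiplication.Theorems.CondensationDistanceShortCondensationStubDodgsonExists

/-!
# Crux `ShortCondensation` (stmt-MatrixMultiplication-15936) — `Lines/schur.lean`, alternative line
(crux-strategist, 2026-08-17; adopted and registered by the line lead prover-line-stmt-MatrixMultiplication-15936-0, 2026-08-17)

Route `CondensationDistance` (route-MatrixMultiplication-CondensationDistance; deciding theorem
`closes : ShortCondensation → CondensationSound → DerivationsBoundOmega → MatrixMultiplication`).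

## The line: Bareiss/Sylvester SCHUR-FRAME transport + sub-scheme recursion + Dodgson floor

Same recursion `D(n) ≤ T(n) + D(⌈n/2⌉)` as the birth line, with the engine cut down to what the
transport actually reads.  Identification (strategist census): the radius-1 ball around the core set
`H_k = {k ≤ x < n+k}` is `{A_k} ∪ adj(A_k) ∪ A_k·(C A_k⁻¹) ∪ A_k·(A_k⁻¹ B) ∪ A_k·(D − C A_k⁻¹ B)` for
`X = [A B; C D]`, i.e. one full 2×2-BLOCK ELIMINATION step; the sub-scheme lift of `J(2n',n')`
(`n' = n − k`: sets containing the core columns `[n,n+k)` and avoiding the core rows `[0,k)`) only ever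
reads its own initial ball, which lifts to the SCHUR SUB-BALL `{A_k} ∪ {bordered (k+1)-minors}`
(`(n−k)² + 1` sets).  So:

* `stub_schurFrame` — **the engine** (weaker than the route's `CheapHalfTransport` BY NAME:
  `schurFrame_of_cheapHalfTransport` below): the Schur sub-ball of `H_{n/2}` in `≤ n^(2+ε)` steps.
  Exact data (strategist, kit j024466 + local exhaustive search): `T_schur(4,2) = 13 < 17 = T_full(4,2)`,
  and `T_schur(4,2) + D(2) = 14 = D(4)` — the Schur recursion is tight at `n = 4`, the full-ball one is not.
* `stub_transportStepSchur` — single-scale transport reading only the Schur sub-ball (M, true).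
* `stub_dodgsonExists` — verbatim the birth line's floor stub (M, true; one proof serves both lines).
* `TightCondensation_of`, `TransportToTight_of` (support item stmt-15943 BY NAME, now through the weaker
  engine), `TightToShort_holds` (support item stmt-15942 BY NAME), `ShortCondensation_of` (the crux BY
  NAME) — PROVED, sorry-free; `ShortCondensation_of_stubs` feeds the declared stubs.

Sorries: ONE — `stub_schurFrame` (the engine).  `stub_transportStepSchur` (p161526) and `stub_dodgsonExists`
(p161651) are discharged by the landed `Theorems/CondensationDistanceShortCondensation<Stub>.lean` files.
-/

-- `Summit.<Summit>.<Problem>`: for the single-conjunct summit the duplicate component is mandated.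
set_option linter.dupNamespace false

namespace Summit.MatrixMultiplication.MatrixMultiplication.Cruxes.ShortCondensation.Schur

open scoped BigOperators Classical
open Summit.MatrixMultiplication.MatrixMultiplication.Theses.CondensationDistance

/-! ## The three registered stubs -/

/-- **Stub 1 — the engine: cheap SCHUR FRAME at depth `k = n/2`** (strictly weaker than the route's
`CheapHalfTransport`, see `schurFrame_of_cheapHalfTransport`): for every `ε > 0` and all large `n` there
is a valid derivation of length `≤ n^(2+ε)` in `J(2n,n)` from the radius-1 ball around `[n]` after which
every `n`-set `J` that contains the core columns `[n, n+k)`, avoids the core rows `[0, k)` and lies within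
distance `1` of `H = {k ≤ x < n+k}` is in the initial ball or listed — i.e. the leading minor `A_k` and its
`(n-k)²` bordered `(k+1)`-minors `X[[0,k)+a, [0,k)+b]` (the Bareiss/Sylvester frame = `A_k` times the
Schur complement), and NOT the adjugate of `A_k` nor the substituted minors.  Size XL / open-problem
(why it might fail: in the unrestricted model this step is one 2×2-block elimination = inversion and two
products of half-size blocks, `Θ(n^ω)`; inside the Plücker model no fast-multiplication mechanism is even
expressible, and exact data give `T_schur(4,2) = 13 = (n-1)²+(n-2)²` (Bareiss) with `13 + D(2) = D(4)`).
Sources: Bareiss1968, BurgisserClausenShokrollahi1997 (§16), Dodgson1867. -/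
theorem stub_schurFrame :
    ∀ ε : ℝ, 0 < ε → ∃ n₀ : ℕ, ∀ n ≥ n₀, ∃ (l : ℕ) (f : Fin l → Finset (Fin (n + n))), (l : ℝ) ≤ (n : ℝ) ^ (2 + ε) ∧ (∀ i : Fin l, ∃ p ∈ f i, ∃ q ∈ f i, p ≠ q ∧ ∃ u ∉ f i, ∃ v ∉ f i, u ≠ v ∧ ∀ J ∈ [insert u ((f i).erase p), insert v ((f i).erase p), insert u ((f i).erase q), insert v ((f i).erase q), insert u (insert v (((f i).erase p).erase q))], (J.card = n ∧ (J.filter fun x : Fin (n + n) => n ≤ x.val).card ≤ 1) ∨ ∃ j : Fin l, j < i ∧ f j = J) ∧ ∀ J : Finset (Fin (n + n)), J.card = n → (J \ (Finset.univ.filter fun x : Fin (n + n) => n / 2 ≤ x.val ∧ x.val < n + n / 2)).card ≤ 1 → (∀ x : Fin (n + n), n ≤ x.val → x.val < n + n / 2 → x ∈ J) → (∀ x ∈ J, n / 2 ≤ x.val) → (J.card = n ∧ (J.filter fun x : Fin (n + n) => n ≤ x.val).card ≤ 1) ∨ ∃ i : Fin l, f i = J := by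
  sorry

/-- **Stub 2 — single-scale sub-scheme transport from the SCHUR SUB-BALL** (the combinatorial content
of the support item `TransportToTight`, stmt-MatrixMultiplication-15943, one scale, no asymptotics, with
the hypothesis cut down to what the lift actually reads): if `k + n' = n`, `f₁` is a valid derivation in
`J(2n,n)` after which every `n`-set containing the core columns `[n,n+k)`, avoiding the core rows `[0,k)`
and within distance `1` of `H_k = {k ≤ x < n + k}` is known, and `f₂` is a valid derivation in `J(2n',n')`
listing its target `{n' ≤ x}`, then some valid derivation in `J(2n,n)` of length `≤ l₁ + l₂` lists the
target `{n ≤ x}` (namely `f₁` followed by `i ↦ [n, n+k) ∪ e (f₂ i)`, `e x = x + k` for `x < n'`,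
`e x = x + 2k` otherwise: the lifted initial ball of `J(2n',n')` is exactly the Schur sub-ball, lifted
octahedra are octahedra, every listed set has cardinality `n'` by induction along `f₂`).  Size M; true.
Sources: Bareiss1968 (Sylvester identity / bordered minors), BurgisserClausenShokrollahi1997. -/
theorem stub_transportStepSchur :
    ∀ (n k n' : ℕ), k + n' = n →
    ∀ (l₁ : ℕ) (f₁ : Fin l₁ → Finset (Fin (n + n))) (l₂ : ℕ) (f₂ : Fin l₂ → Finset (Fin (n' + n'))),
      (∀ i : Fin l₁, ∃ p ∈ f₁ i, ∃ q ∈ f₁ i, p ≠ q ∧ ∃ u ∉ f₁ i, ∃ v ∉ f₁ i, u ≠ v ∧ ∀ J ∈ [insert u ((f₁ i).erase p), insert v ((f₁ i).erase p), insert u ((f₁ i).erase q), insert v ((f₁ i).erase q), insert u (insert v (((f₁ i).erase p).erase q))], (J.card = n ∧ (J.filter fun x : Fin (n + n) => n ≤ x.val).card ≤ 1) ∨ ∃ j : Fin l₁, j < i ∧ f₁ j = J) →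
      (∀ J : Finset (Fin (n + n)), J.card = n → (J \ (Finset.univ.filter fun x : Fin (n + n) => k ≤ x.val ∧ x.val < n + k)).card ≤ 1 → (∀ x : Fin (n + n), n ≤ x.val → x.val < n + k → x ∈ J) → (∀ x ∈ J, k ≤ x.val) → (J.card = n ∧ (J.filter fun x : Fin (n + n) => n ≤ x.val).card ≤ 1) ∨ ∃ i : Fin l₁, f₁ i = J) →
      (∀ i : Fin l₂, ∃ p ∈ f₂ i, ∃ q ∈ f₂ i, p ≠ q ∧ ∃ u ∉ f₂ i, ∃ v ∉ f₂ i, u ≠ v ∧ ∀ J ∈ [insert u ((f₂ i).erase p), insert v ((f₂ i).erase p), insert u ((f₂ i).erase q), insert v ((f₂ i).erase q), insert u (insert v (((f₂ i).erase p).erase q))], (J.card = n' ∧ (J.filter fun x : Fin (n' + n') => n' ≤ x.val).card ≤ 1) ∨ ∃ j : Fin l₂, j < i ∧ f₂ j = J) →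
      (∃ i : Fin l₂, f₂ i = Finset.univ.filter fun x : Fin (n' + n') => n' ≤ x.val) →
      ∃ (l : ℕ) (f : Fin l → Finset (Fin (n + n))), l ≤ l₁ + l₂ ∧
        (∀ i : Fin l, ∃ p ∈ f i, ∃ q ∈ f i, p ≠ q ∧ ∃ u ∉ f i, ∃ v ∉ f i, u ≠ v ∧ ∀ J ∈ [insert u ((f i).erase p), insert v ((f i).erase p), insert u ((f i).erase q), insert v ((f i).erase q), insert u (insert v (((f i).erase p).erase q))], (J.card = n ∧ (J.filter fun x : Fin (n + n) => n ≤ x.val).card ≤ 1) ∨ ∃ j : Fin l, j < i ∧ f j = J) ∧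
        ∃ i : Fin l, f i = Finset.univ.filter fun x : Fin (n + n) => n ≤ x.val :=
  Summit.MatrixMultiplication.MatrixMultiplication.Theorems.ShortCondensation.stub_transportStepSchur

/-- **Stub 3 — qualitative Dodgson condensation** (the recursion floor): for every `n ≥ 2` some valid
derivation in `J(2n,n)` of length `≤ n³` lists the target `{n ≤ x}` — Dodgson's condensation read as a
monotone derivation: list the contiguous `h × h` minors for `h = 2, …, n` (`Σ_{h} (n−h+1)² ≤ n³` steps),
each justified by the Desnanot–Jacobi octahedron (`p, q` the extreme columns of the minor, `u, v` its
extreme rows; the five mates are contiguous minors of sizes `h−1` (four) and `h−2`, i.e. entries / `1`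
or listed earlier).  Size M; true.  (At `n = 1` NO derivation exists — the refuter's `decide` — so a
floor hypothesis of this kind is unavoidable.)  Sources: Dodgson1867, Bareiss1968,
FallatJohnson2011 (§1.2, the short Plücker relation). -/
theorem stub_dodgsonExists :
    ∀ n : ℕ, 2 ≤ n → ∃ (l : ℕ) (f : Fin l → Finset (Fin (n + n))), l ≤ n ^ 3 ∧
      (∀ i : Fin l, ∃ p ∈ f i, ∃ q ∈ f i, p ≠ q ∧ ∃ u ∉ f i, ∃ v ∉ f i, u ≠ v ∧ ∀ J ∈ [insert u ((f i).erase p), insert v ((f i).erase p), insert u ((f i).erase q), insert v ((f i).erase q), insert u (insert v (((f i).erase p).erase q))], (J.card = n ∧ (J.filter fun x : Fin (n + n) => n ≤ x.val).card ≤ 1) ∨ ∃ j : Fin l, j < i ∧ f j = J) ∧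
      ∃ i : Fin l, f i = Finset.univ.filter fun x : Fin (n + n) => n ≤ x.val :=
  Summit.MatrixMultiplication.MatrixMultiplication.Theorems.ShortCondensation.stub_dodgsonExists

/-! ## Sorry-free core -/

/-- **The Schur engine is implied by the route's `CheapHalfTransport` (stmt-MatrixMultiplication-15938),
BY NAME**: the birth line's engine asks for the whole radius-1 ball around `H` (`n² + 1` sets, including
the `k²` cofactors of the leading block and the `2k(n-k)` row/column-substituted minors); the Schur engine
asks only for the `(n-k)² + 1` sets of the sub-ball (the leading minor `A_k` and its bordered minors), so it
is the weaker hypothesis and every proof of `CheapHalfTransport` discharges `stub_schurFrame`. [folklore] -/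
theorem schurFrame_of_cheapHalfTransport (h : CheapHalfTransport) :
    ∀ ε : ℝ, 0 < ε → ∃ n₀ : ℕ, ∀ n ≥ n₀, ∃ (l : ℕ) (f : Fin l → Finset (Fin (n + n))), (l : ℝ) ≤ (n : ℝ) ^ (2 + ε) ∧ (∀ i : Fin l, ∃ p ∈ f i, ∃ q ∈ f i, p ≠ q ∧ ∃ u ∉ f i, ∃ v ∉ f i, u ≠ v ∧ ∀ J ∈ [insert u ((f i).erase p), insert v ((f i).erase p), insert u ((f i).erase q), insert v ((f i).erase q), insert u (insert v (((f i).erase p).erase q))], (J.card = n ∧ (J.filter fun x : Fin (n + n) => n ≤ x.val).card ≤ 1) ∨ ∃ j : Fin l, j < i ∧ f j = J) ∧ ∀ J : Finset (Fin (n + n)), J.card = n → (J \ (Finset.univ.filter fun x : Fin (n + n) => n / 2 ≤ x.val ∧ x.val < n + n / 2)).card ≤ 1 → (∀ x : Fin (n + n), n ≤ x.val → x.val < n + n / 2 → x ∈ J) → (∀ x ∈ J, n / 2 ≤ x.val) → (J.card = n ∧ (J.filter fun x : Fin (n + n) => n ≤ x.val).card ≤ 1) ∨ ∃ i : Fin l,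 f i = J := by
  intro ε hε
  obtain ⟨n₀, hn₀⟩ := h ε hε
  refine ⟨n₀, fun n hn => ?_⟩
  obtain ⟨l, f, hl, hv, hk⟩ := hn₀ n hn
  exact ⟨l, f, hl, hv, fun J hJ hd _ _ => hk J hJ hd⟩

/-- **The quantitative recursion (proved).** From the three stub STATEMENTS: `TightCondensation`
(stmt-MatrixMultiplication-15937) — `D(n) ≤ T(n) + D(⌈n/2⌉)` iterated down to the floor, geometric sum.
In particular stubs 2 and 3 alone prove the support item `TransportToTight` (via
`schurFrame_of_cheapHalfTransport`). [folklore] -/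
theorem TightCondensation_of
    (h₁ : ∀ ε : ℝ, 0 < ε → ∃ n₀ : ℕ, ∀ n ≥ n₀, ∃ (l : ℕ) (f : Fin l → Finset (Fin (n + n))), (l : ℝ) ≤ (n : ℝ) ^ (2 + ε) ∧ (∀ i : Fin l, ∃ p ∈ f i, ∃ q ∈ f i, p ≠ q ∧ ∃ u ∉ f i, ∃ v ∉ f i, u ≠ v ∧ ∀ J ∈ [insert u ((f i).erase p), insert v ((f i).erase p), insert u ((f i).erase q), insert v ((f i).erase q), insert u (insert v (((f i).erase p).erase q))], (J.card = n ∧ (J.filter fun x : Fin (n + n) => n ≤ x.val).card ≤ 1) ∨ ∃ j : Fin l, j < i ∧ f j = J) ∧ ∀ J : Finset (Fin (n + n)), J.card = n → (J \ (Finset.univ.filter fun x : Fin (n + n) => n / 2 ≤ x.val ∧ x.val < n + n / 2)).card ≤ 1 → (∀ x : Fin (n + n), n ≤ x.val → x.val < n + n / 2 → x ∈ J) → (∀ x ∈ J, n / 2 ≤ x.val) → (J.card = n ∧ (J.filter fun x : Fin (n + n) => n ≤ x.val).card ≤ 1) ∨ ∃ i : Fin l, f i = J)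
    (h₂ : ∀ (n k n' : ℕ), k + n' = n →
      ∀ (l₁ : ℕ) (f₁ : Fin l₁ → Finset (Fin (n + n))) (l₂ : ℕ) (f₂ : Fin l₂ → Finset (Fin (n' + n'))),
      (∀ i : Fin l₁, ∃ p ∈ f₁ i, ∃ q ∈ f₁ i, p ≠ q ∧ ∃ u ∉ f₁ i, ∃ v ∉ f₁ i, u ≠ v ∧ ∀ J ∈ [insert u ((f₁ i).erase p), insert v ((f₁ i).erase p), insert u ((f₁ i).erase q), insert v ((f₁ i).erase q), insert u (insert v (((f₁ i).erase p).erase q))], (J.card = n ∧ (J.filter fun x : Fin (n + n) => n ≤ x.val).card ≤ 1) ∨ ∃ j : Fin l₁, j < i ∧ f₁ j = J) →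
      (∀ J : Finset (Fin (n + n)), J.card = n → (J \ (Finset.univ.filter fun x : Fin (n + n) => k ≤ x.val ∧ x.val < n + k)).card ≤ 1 → (∀ x : Fin (n + n), n ≤ x.val → x.val < n + k → x ∈ J) → (∀ x ∈ J, k ≤ x.val) → (J.card = n ∧ (J.filter fun x : Fin (n + n) => n ≤ x.val).card ≤ 1) ∨ ∃ i : Fin l₁, f₁ i = J) →
      (∀ i : Fin l₂, ∃ p ∈ f₂ i, ∃ q ∈ f₂ i, p ≠ q ∧ ∃ u ∉ f₂ i, ∃ v ∉ f₂ i, u ≠ v ∧ ∀ J ∈ [insert u ((f₂ i).erase p), insert v ((f₂ i).erase p), insert u ((f₂ i).erase q), insert v ((f₂ i).erase q), insert u (insert v (((f₂ i).erase p).erase q))], (J.card = n' ∧ (J.filter fun x : Fin (n' + n') => n' ≤ x.val).card ≤ 1) ∨ ∃ j : Fin l₂, j < i ∧ f₂ j = J) →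
      (∃ i : Fin l₂, f₂ i = Finset.univ.filter fun x : Fin (n' + n') => n' ≤ x.val) →
      ∃ (l : ℕ) (f : Fin l → Finset (Fin (n + n))), l ≤ l₁ + l₂ ∧
        (∀ i : Fin l, ∃ p ∈ f i, ∃ q ∈ f i, p ≠ q ∧ ∃ u ∉ f i, ∃ v ∉ f i, u ≠ v ∧ ∀ J ∈ [insert u ((f i).erase p), insert v ((f i).erase p), insert u ((f i).erase q), insert v ((f i).erase q), insert u (insert v (((f i).erase p).erase q))], (J.card = n ∧ (J.filter fun x : Fin (n + n) => n ≤ x.val).card ≤ 1) ∨ ∃ j : Fin l, j < i ∧ f j = J) ∧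
        ∃ i : Fin l, f i = Finset.univ.filter fun x : Fin (n + n) => n ≤ x.val)
    (h₃ : ∀ n : ℕ, 2 ≤ n → ∃ (l : ℕ) (f : Fin l → Finset (Fin (n + n))), l ≤ n ^ 3 ∧
      (∀ i : Fin l, ∃ p ∈ f i, ∃ q ∈ f i, p ≠ q ∧ ∃ u ∉ f i, ∃ v ∉ f i, u ≠ v ∧ ∀ J ∈ [insert u ((f i).erase p), insert v ((f i).erase p), insert u ((f i).erase q), insert v ((f i).erase q), insert u (insert v (((f i).erase p).erase q))], (J.card = n ∧ (J.filter fun x : Fin (n + n) => n ≤ x.val).card ≤ 1) ∨ ∃ j : Fin l, j < i ∧ f j = J) ∧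
      ∃ i : Fin l, f i = Finset.univ.filter fun x : Fin (n + n) => n ≤ x.val) :
    TightCondensation := by
  intro ε hε
  have hε2 : 0 < ε / 2 := half_pos hε
  obtain ⟨n₀, hn₀⟩ := h₁ (ε / 2) hε2
  -- the floor threshold `N ≥ n₀, 3`
  obtain ⟨N, hNn₀, hN3⟩ : ∃ N : ℕ, n₀ ≤ N ∧ 3 ≤ N := ⟨max n₀ 3, le_max_left _ _, le_max_right _ _⟩
  -- KEY RECURSION: every `n ≥ 2` has a valid derivation listing the target of length
  -- `≤ N³ + 2·n^(2+ε/2)` (floor below `N`, engine + transport + induction above).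
  have key : ∀ n : ℕ, 2 ≤ n → ∃ (l : ℕ) (f : Fin l → Finset (Fin (n + n))),
      (∀ i : Fin l, ∃ p ∈ f i, ∃ q ∈ f i, p ≠ q ∧ ∃ u ∉ f i, ∃ v ∉ f i, u ≠ v ∧ ∀ J ∈ [insert u ((f i).erase p), insert v ((f i).erase p), insert u ((f i).erase q), insert v ((f i).erase q), insert u (insert v (((f i).erase p).erase q))], (J.card = n ∧ (J.filter fun x : Fin (n + n) => n ≤ x.val).card ≤ 1) ∨ ∃ j : Fin l, j < i ∧ f j = J) ∧
      (∃ i : Fin l, f i = Finset.univ.filter fun x : Fin (n + n) => n ≤ x.val) ∧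
      (l : ℝ) ≤ (N : ℝ) ^ (3 : ℕ) + 2 * (n : ℝ) ^ (2 + ε / 2) := by
    intro n
    induction n using Nat.strong_induction_on with
    | _ n ih =>
      intro h2n
      rcases Nat.lt_or_ge n N with hlt | hge
      · -- floor: an explicit (Dodgson) derivation of length ≤ n³ ≤ N³
        obtain ⟨l, f, hl, hv, ht⟩ := h₃ n h2n
        refine ⟨l, f, hv, ht, ?_⟩
        have hlN : (l : ℝ) ≤ (N : ℝ) ^ (3 : ℕ) := by
          have h : l ≤ N ^ 3 := hl.trans (Nat.pow_le_pow_left hlt.le 3)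
          exact_mod_cast h
        have h0 : (0 : ℝ) ≤ 2 * (n : ℝ) ^ (2 + ε / 2) := by positivity
        linarith
      · -- engine at scale `n`, transport, recursive call at `n' = n - n / 2 = ⌈n/2⌉`
        have hn₀n : n₀ ≤ n := hNn₀.trans hge
        have h3n : 3 ≤ n := hN3.trans hge
        obtain ⟨l₁, f₁, hl₁, hv₁, hk₁⟩ := hn₀ n hn₀n
        have hlt' : n - n / 2 < n := by omega
        have h2n' : 2 ≤ n - n / 2 := by omega
        obtain ⟨l₂, f₂, hv₂, ht₂, hl₂⟩ := ih (n - n / 2) hlt' h2n'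
        obtain ⟨l, f, hl, hv, ht⟩ :=
          h₂ n (n / 2) (n - n / 2) (by omega) l₁ f₁ l₂ f₂ hv₁ hk₁ hv₂ ht₂
        refine ⟨l, f, hv, ht, ?_⟩
        have hcast : (l : ℝ) ≤ (l₁ : ℝ) + (l₂ : ℝ) := by exact_mod_cast hl
        have hn' : ((n - n / 2 : ℕ) : ℝ) ≤ 2 / 3 * (n : ℝ) := by
          have h : 3 * (n - n / 2) ≤ 2 * n := by omega
          have h' : (3 : ℝ) * ((n - n / 2 : ℕ) : ℝ) ≤ 2 * (n : ℝ) := by exact_mod_cast h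
          linarith
        have hs : (0 : ℝ) ≤ 2 + ε / 2 := by linarith
        have h49 : (2 / 3 : ℝ) ^ (2 + ε / 2) ≤ 4 / 9 :=
          calc (2 / 3 : ℝ) ^ (2 + ε / 2) ≤ (2 / 3 : ℝ) ^ (2 : ℝ) :=
                Real.rpow_le_rpow_of_exponent_ge (by norm_num) (by norm_num) (by linarith)
            _ = 4 / 9 := by rw [Real.rpow_two]; norm_num
        have hpow : ((n - n / 2 : ℕ) : ℝ) ^ (2 + ε / 2) ≤ 4 / 9 * (n : ℝ) ^ (2 + ε / 2) :=
          calc ((n - n / 2 : ℕ) : ℝ) ^ (2 + ε / 2)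
              ≤ (2 / 3 * (n : ℝ)) ^ (2 + ε / 2) := Real.rpow_le_rpow (by positivity) hn' hs
            _ = (2 / 3 : ℝ) ^ (2 + ε / 2) * (n : ℝ) ^ (2 + ε / 2) :=
                Real.mul_rpow (by norm_num) (by positivity)
            _ ≤ 4 / 9 * (n : ℝ) ^ (2 + ε / 2) :=
                mul_le_mul_of_nonneg_right h49 (by positivity)
        have h0 : (0 : ℝ) ≤ (n : ℝ) ^ (2 + ε / 2) := by positivity
        linarith
  -- THRESHOLD: `N³ + 2·n^(2+ε/2) ≤ n^(2+ε)` as soon as `n^(ε/2) ≥ N³ + 2`.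
  have hev : ∀ᶠ n : ℕ in Filter.atTop, (N : ℝ) ^ (3 : ℕ) + 2 ≤ (n : ℝ) ^ (ε / 2) :=
    ((tendsto_rpow_atTop hε2).comp tendsto_natCast_atTop_atTop).eventually_ge_atTop _
  obtain ⟨n₁, hn₁⟩ := Filter.eventually_atTop.1 hev
  refine ⟨max n₁ 2, fun n hn => ?_⟩
  have hn1 : n₁ ≤ n := le_trans (le_max_left _ _) hn
  have hn2 : 2 ≤ n := le_trans (le_max_right _ _) hn
  obtain ⟨l, f, hv, ht, hl⟩ := key n hn2
  refine ⟨l, f, ?_, hv, ht⟩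
  have hnpos : (0 : ℝ) < n := by exact_mod_cast (show 0 < n by omega)
  have h1n : (1 : ℝ) ≤ n := by exact_mod_cast (show 1 ≤ n by omega)
  have hA : (1 : ℝ) ≤ (n : ℝ) ^ (2 + ε / 2) := Real.one_le_rpow h1n (by linarith)
  have hB : (N : ℝ) ^ (3 : ℕ) + 2 ≤ (n : ℝ) ^ (ε / 2) := hn₁ n hn1
  have hsplit : (n : ℝ) ^ (2 + ε) = (n : ℝ) ^ (2 + ε / 2) * (n : ℝ) ^ (ε / 2) := by
    rw [← Real.rpow_add hnpos]; congr 1; ring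
  rw [hsplit]
  have hN0 : (0 : ℝ) ≤ (N : ℝ) ^ (3 : ℕ) := by positivity
  have hstep1 : (n : ℝ) ^ (2 + ε / 2) * ((N : ℝ) ^ (3 : ℕ) + 2) ≤
      (n : ℝ) ^ (2 + ε / 2) * (n : ℝ) ^ (ε / 2) :=
    mul_le_mul_of_nonneg_left hB (by positivity)
  have hstep2 : (N : ℝ) ^ (3 : ℕ) ≤ (n : ℝ) ^ (2 + ε / 2) * (N : ℝ) ^ (3 : ℕ) :=
    le_mul_of_one_le_left hN0 hA
  linarith

/-- **`TransportToTight` (support item stmt-MatrixMultiplication-15943, `CheapHalfTransport → TightCondensation`)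
from stubs 2 and 3 alone, BY NAME**: the route's `CheapHalfTransport` implies the Schur engine
(`schurFrame_of_cheapHalfTransport`), so the two true combinatorial stubs are exactly what the support
item costs — the Schur line dominates the birth line. [folklore] -/
theorem TransportToTight_of
    (h₂ : ∀ (n k n' : ℕ), k + n' = n →
      ∀ (l₁ : ℕ) (f₁ : Fin l₁ → Finset (Fin (n + n))) (l₂ : ℕ) (f₂ : Fin l₂ → Finset (Fin (n' + n'))),
      (∀ i : Fin l₁, ∃ p ∈ f₁ i, ∃ q ∈ f₁ i, p ≠ q ∧ ∃ u ∉ f₁ i, ∃ v ∉ f₁ i, u ≠ v ∧ ∀ J ∈ [insert u ((f₁ i).erase p), insert v ((f₁ i).erase p), insert u ((f₁ i).erase q), insert v ((f₁ i).erase q), insert u (insert v (((f₁ i).erase p).erase q))], (J.card = n ∧ (J.filter fun x : Fin (n + n) => n ≤ x.val).card ≤ 1) ∨ ∃ j : Fin l₁, j < i ∧ f₁ j = J) →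
      (∀ J : Finset (Fin (n + n)), J.card = n → (J \ (Finset.univ.filter fun x : Fin (n + n) => k ≤ x.val ∧ x.val < n + k)).card ≤ 1 → (∀ x : Fin (n + n), n ≤ x.val → x.val < n + k → x ∈ J) → (∀ x ∈ J, k ≤ x.val) → (J.card = n ∧ (J.filter fun x : Fin (n + n) => n ≤ x.val).card ≤ 1) ∨ ∃ i : Fin l₁, f₁ i = J) →
      (∀ i : Fin l₂, ∃ p ∈ f₂ i, ∃ q ∈ f₂ i, p ≠ q ∧ ∃ u ∉ f₂ i, ∃ v ∉ f₂ i, u ≠ v ∧ ∀ J ∈ [insert u ((f₂ i).erase p), insert v ((f₂ i).erase p), insert u ((f₂ i).erase q), insert v ((f₂ i).erase q), insert u (insert v (((f₂ i).erase p).erase q))], (J.card = n' ∧ (J.filter fun x : Fin (n' + n') => n' ≤ x.val).card ≤ 1) ∨ ∃ j : Fin l₂, j < i ∧ f₂ j = J) →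
      (∃ i : Fin l₂, f₂ i = Finset.univ.filter fun x : Fin (n' + n') => n' ≤ x.val) →
      ∃ (l : ℕ) (f : Fin l → Finset (Fin (n + n))), l ≤ l₁ + l₂ ∧
        (∀ i : Fin l, ∃ p ∈ f i, ∃ q ∈ f i, p ≠ q ∧ ∃ u ∉ f i, ∃ v ∉ f i, u ≠ v ∧ ∀ J ∈ [insert u ((f i).erase p), insert v ((f i).erase p), insert u ((f i).erase q), insert v ((f i).erase q), insert u (insert v (((f i).erase p).erase q))], (J.card = n ∧ (J.filter fun x : Fin (n + n) => n ≤ x.val).card ≤ 1) ∨ ∃ j : Fin l, j < i ∧ f j = J) ∧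
        ∃ i : Fin l, f i = Finset.univ.filter fun x : Fin (n + n) => n ≤ x.val)
    (h₃ : ∀ n : ℕ, 2 ≤ n → ∃ (l : ℕ) (f : Fin l → Finset (Fin (n + n))), l ≤ n ^ 3 ∧
      (∀ i : Fin l, ∃ p ∈ f i, ∃ q ∈ f i, p ≠ q ∧ ∃ u ∉ f i, ∃ v ∉ f i, u ≠ v ∧ ∀ J ∈ [insert u ((f i).erase p), insert v ((f i).erase p), insert u ((f i).erase q), insert v ((f i).erase q), insert u (insert v (((f i).erase p).erase q))], (J.card = n ∧ (J.filter fun x : Fin (n + n) => n ≤ x.val).card ≤ 1) ∨ ∃ j : Fin l, j < i ∧ f j = J) ∧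
      ∃ i : Fin l, f i = Finset.univ.filter fun x : Fin (n + n) => n ≤ x.val) :
    TransportToTight :=
  fun h₁ => TightCondensation_of (schurFrame_of_cheapHalfTransport h₁) h₂ h₃

/-- **`TightToShort` (support item stmt-MatrixMultiplication-15942, `TightCondensation → ShortCondensation`),
proved BY NAME**: a tight derivation is a short one with `m' = n ≤ n ^ 1` auxiliary width; the targets
`{n ≤ x}` and `{n ≤ x < 2n}` coincide on `Fin (n + n)`.  (A prover may lift this verbatim into
`Theorems/`; here it is the last link of the skeleton.) [folklore] -/
theorem TightToShort_holds : TightToShort := by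
  intro hT ε hε
  obtain ⟨n₀, hn₀⟩ := hT ε hε
  refine ⟨1, n₀, fun n hn => ⟨n, le_rfl, by simp, ?_⟩⟩
  obtain ⟨l, f, hl, hv, i, hi⟩ := hn₀ n hn
  refine ⟨l, f, hl, hv, i, ?_⟩
  rw [hi]
  refine Finset.filter_congr fun x _ => ⟨fun h => ⟨h, ?_⟩, fun h => h.1⟩
  have hx := x.isLt
  omega

/-! ## The composition: the three stub statements prove the crux BY NAME -/

/-- **THE SKELETON THEOREM.** The crux
`Summit.MatrixMultiplication.MatrixMultiplication.Theses.CondensationDistance.ShortCondensation`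
(stmt-MatrixMultiplication-15936) from the three stub STATEMENTS as hypotheses: Schur engine (stub 1) +
single-scale sub-ball transport (stub 2) + Dodgson floor (stub 3) ⟹ `TightCondensation` (the recursion,
`TightCondensation_of`) ⟹ `ShortCondensation` (`TightToShort_holds`).  Sorry-free. [folklore] -/
theorem ShortCondensation_of :
    (∀ ε : ℝ, 0 < ε → ∃ n₀ : ℕ, ∀ n ≥ n₀, ∃ (l : ℕ) (f : Fin l → Finset (Fin (n + n))), (l : ℝ) ≤ (n : ℝ) ^ (2 + ε) ∧ (∀ i : Fin l, ∃ p ∈ f i, ∃ q ∈ f i, p ≠ q ∧ ∃ u ∉ f i, ∃ v ∉ f i, u ≠ v ∧ ∀ J ∈ [insert u ((f i).erase p), insert v ((f i).erase p), insert u ((f i).erase q), insert v ((f i).erase q), insert u (insert v (((f i).erase p).erase q))], (J.card = n ∧ (J.filter fun x : Fin (n + n) => n ≤ x.val).card ≤ 1) ∨ ∃ j : Fin l, j < i ∧ f j = J) ∧ ∀ J : Finset (Fin (n + n)), J.card = n → (J \ (Finset.univ.filter fun x : Fin (n + n) => n / 2 ≤ x.val ∧ x.val < n + n / 2)).card ≤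 1 → (∀ x : Fin (n + n), n ≤ x.val → x.val < n + n / 2 → x ∈ J) → (∀ x ∈ J, n / 2 ≤ x.val) → (J.card = n ∧ (J.filter fun x : Fin (n + n) => n ≤ x.val).card ≤ 1) ∨ ∃ i : Fin l, f i = J) →
    (∀ (n k n' : ℕ), k + n' = n →
      ∀ (l₁ : ℕ) (f₁ : Fin l₁ → Finset (Fin (n + n))) (l₂ : ℕ) (f₂ : Fin l₂ → Finset (Fin (n' + n'))),
      (∀ i : Fin l₁, ∃ p ∈ f₁ i, ∃ q ∈ f₁ i, p ≠ q ∧ ∃ u ∉ f₁ i, ∃ v ∉ f₁ i, u ≠ v ∧ ∀ J ∈ [insert u ((f₁ i).erase p), insert v ((f₁ i).erase p), insert u ((f₁ i).erase q), insert v ((f₁ i).erase q), insert u (insert v (((f₁ i).erase p).erase q))], (J.card = n ∧ (J.filter fun x : Fin (n + n) => n ≤ x.val).card ≤ 1) ∨ ∃ j : Fin l₁, j < i ∧ f₁ j = J) →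
      (∀ J : Finset (Fin (n + n)), J.card = n → (J \ (Finset.univ.filter fun x : Fin (n + n) => k ≤ x.val ∧ x.val < n + k)).card ≤ 1 → (∀ x : Fin (n + n), n ≤ x.val → x.val < n + k → x ∈ J) → (∀ x ∈ J, k ≤ x.val) → (J.card = n ∧ (J.filter fun x : Fin (n + n) => n ≤ x.val).card ≤ 1) ∨ ∃ i : Fin l₁, f₁ i = J) →
      (∀ i : Fin l₂, ∃ p ∈ f₂ i, ∃ q ∈ f₂ i, p ≠ q ∧ ∃ u ∉ f₂ i, ∃ v ∉ f₂ i, u ≠ v ∧ ∀ J ∈ [insert u ((f₂ i).erase p), insert v ((f₂ i).erase p), insert u ((f₂ i).erase q), insert v ((f₂ i).erase q), insert u (insert v (((f₂ i).erase p).erase q))], (J.card = n' ∧ (J.filter fun x : Fin (n' + n') => n' ≤ x.val).card ≤ 1) ∨ ∃ j : Fin l₂, j < i ∧ f₂ j = J) →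
      (∃ i : Fin l₂, f₂ i = Finset.univ.filter fun x : Fin (n' + n') => n' ≤ x.val) →
      ∃ (l : ℕ) (f : Fin l → Finset (Fin (n + n))), l ≤ l₁ + l₂ ∧
        (∀ i : Fin l, ∃ p ∈ f i, ∃ q ∈ f i, p ≠ q ∧ ∃ u ∉ f i, ∃ v ∉ f i, u ≠ v ∧ ∀ J ∈ [insert u ((f i).erase p), insert v ((f i).erase p), insert u ((f i).erase q), insert v ((f i).erase q), insert u (insert v (((f i).erase p).erase q))], (J.card = n ∧ (J.filter fun x : Fin (n + n) => n ≤ x.val).card ≤ 1) ∨ ∃ j : Fin l, j < i ∧ f j = J) ∧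
        ∃ i : Fin l, f i = Finset.univ.filter fun x : Fin (n + n) => n ≤ x.val) →
    (∀ n : ℕ, 2 ≤ n → ∃ (l : ℕ) (f : Fin l → Finset (Fin (n + n))), l ≤ n ^ 3 ∧
      (∀ i : Fin l, ∃ p ∈ f i, ∃ q ∈ f i, p ≠ q ∧ ∃ u ∉ f i, ∃ v ∉ f i, u ≠ v ∧ ∀ J ∈ [insert u ((f i).erase p), insert v ((f i).erase p), insert u ((f i).erase q), insert v ((f i).erase q), insert u (insert v (((f i).erase p).erase q))], (J.card = n ∧ (J.filter fun x : Fin (n + n) => n ≤ x.val).card ≤ 1) ∨ ∃ j : Fin l, j < i ∧ f j = J) ∧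
      ∃ i : Fin l, f i = Finset.univ.filter fun x : Fin (n + n) => n ≤ x.val) →
    Summit.MatrixMultiplication.MatrixMultiplication.Theses.CondensationDistance.ShortCondensation :=
  fun h₁ h₂ h₃ =>
    (show TightCondensation → ShortCondensation from TightToShort_holds) (TightCondensation_of h₁ h₂ h₃)

/-- The crux fed with the three DECLARED stubs (closed only through their `sorry`s; this is the shape
the line's provers discharge stub by stub). [folklore] -/
theorem ShortCondensation_of_stubs :
    Summit.MatrixMultiplication.MatrixMultiplication.Theses.CondensationDistance.ShortCondensation :=
  ShortCondensation_of stub_schurFrame stub_transportStepSchur stub_dodgsonExists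

end Summit.MatrixMultiplication.MatrixMultiplication.Cruxes.ShortCondensation.Schur
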